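import Literature.Computability.AlgebraicComplexity.FSV18GeneratorShiftUpgrade
import Literature.Computability.AlgebraicComplexity.ASSS16UnitShiftLemma
import Literature.Computability.AlgebraicComplexity.FSV2018ROABP
import HarnessLib

/-!
# The shift reduction of [ASSS16, §4 ¶1] for succinct generators, assembled (val-lit p1 g3;
# N1 occur push, lead-np RULING (31), plan HOME/np/p1g3-THM48-provenance-and-plan.md §3 / F5)

Sources: [ASSS16] = arXiv:1111.0582 §4 ¶1 (held `paper:arxiv-1111.0582` p0009:L3–L22);
[ForbesShpilkaVolk2018] Fact 27 / Cor. 49 (ToC 5.3 / 5.25). Theorems only.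

`ASSS16.isHittingSetGenerator_succ_of_unitDifferences`: for ANY class `𝒞` of polynomials in the
multilinear coefficient variables whose members have total degree below the characteristic (or
`char = 0`), if `G ⊕ G^{SV'}_{n,K}` is a hitting-set generator for the class of UNIT DIFFERENCES
`{C(X + e_{m₀}) − C(X) : C ∈ 𝒞, m₀}`, then `G ⊕ G^{SV'}_{n,K+1}` is a hitting-set generator for `𝒞`
— the two halves `isHittingSetGenerator_svGenCoeff_succ_of_shift` (generator form of the shift,
`FSV18GeneratorShiftUpgrade.lean`) and `exists_shift_sub_ne_zero` (a non-constant polynomial has a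
non-zero unit difference, `ASSS16UnitShiftLemma.lean`) combined. With `𝒞 = occurClass D k s` and
`G` = the Vandermonde blocks of FSV Construction 46 this is the step that replaces FSV Thm. 48's
unbounded top fan-in by [ASSS16]'s bounded one (the unit differences of depth-`D` occur-`k`
formulas are depth-`(D+1)` occur-`2k` formulas with top fan-in `≤ 2k`, [ASSS16] p0009:L10–L13 —
a formula-model statement left to the F2 files). Honest framing: `VP ≠ VNP` is NOT proved.
-/

noncomputable section

namespace Literature.Computability.AlgebraicComplexity

namespace ASSS16

open MvPolynomial Finset Literature.Barriers.ValiantsHypothesis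

variable {F : Type*} [Field F] {n : ℕ}

/-- **[ASSS16, §4 ¶1] for succinct generators with an SV block:** "if `C` is non-constant and
nonzero, then there is an `i` such that `C̃ := C(…, x_i + 1, …) − C ≠ 0` … Suppose `ℋ̃` is a
hitting-set for the class `𝒞̃`. Form `ℋ ⊇ ℋ̃` by including points `α + e_i` … `ℋ` is a hitting-set
for `𝒞`" — here: a hitting-set GENERATOR `G ⊕ G^{SV'}_{n,K}` for the unit-difference class of `𝒞`
upgrades to the generator `G ⊕ G^{SV'}_{n,K+1}` for `𝒞` (one more SV block supplies the shift,
FSV Fact 27), for members of total degree below the characteristic.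
[cite: AgrawalEtAl2011, §4 (¶1); ForbesShpilkaVolk2018, Fact 27 (seq.) = ToC Fact 5.3]
locator: paper:arxiv-1111.0582 p0009.txt:L3–L22 -/
theorem isHittingSetGenerator_succ_of_unitDifferences {τ : Type*} (K : ℕ)
    (G : multilinearMonomials n → MvPolynomial τ F)
    (𝒞 : Set (MvPolynomial (multilinearMonomials n) F))
    (hchar : ∀ C₀ ∈ 𝒞, ringChar F = 0 ∨ C₀.totalDegree < ringChar F)
    (hgen : IsHittingSetGenerator
      {g : MvPolynomial (multilinearMonomials n) F | ∃ C₀ ∈ 𝒞, ∃ m₀ : multilinearMonomials n,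
        g = aeval (fun m : multilinearMonomials n =>
          if m = m₀ then X m + C 1 else (X m : MvPolynomial (multilinearMonomials n) F)) C₀ - C₀}
      (fun m : multilinearMonomials n =>
        rename Sum.inl (G m) + rename Sum.inr (svGenCoeff F n K (m : Fin n →₀ ℕ)))) :
    IsHittingSetGenerator 𝒞
      (fun m : multilinearMonomials n =>
        rename Sum.inl (G m) + rename Sum.inr (svGenCoeff F n (K + 1) (m : Fin n →₀ ℕ))) := by
  classical
  haveI : Fintype (multilinearMonomials n) := Fintype.ofEquiv (Fin (2 ^ n)) (binaryOrder n)
  refine isHittingSetGenerator_svGenCoeff_succ_of_shift K G 𝒞 _ (fun C₀ hC₀ _ => ?_) hgen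
  by_cases hdeg : C₀.totalDegree = 0
  · exact Or.inl ⟨coeff 0 C₀, (totalDegree_eq_zero_iff_eq_C).1 hdeg⟩
  · obtain ⟨m₀, hm₀⟩ := exists_shift_sub_ne_zero C₀ hdeg (hchar C₀ hC₀)
    exact Or.inr ⟨m₀, ⟨C₀, hC₀, m₀, rfl⟩, hm₀⟩

end ASSS16

end Literature.Computability.AlgebraicComplexity

end
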